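import Summits.Parity.GeneralizedHardyLittlewood.Theorems.PrimeLevelFamEdgeMomentsBeyondDiagonalDiagBoseMixedProfile
import Summits.Parity.GeneralizedHardyLittlewood.Theorems.PrimeLevelFamEdgeMomentsBeyondDiagonalDiagBoseMixedShell
import HarnessLib

/-!
# Route `PrimeLevelFamEdge`, crux K_A `MomentsBeyondDiagonal` (stmt-Parity-20007), line «petersson_layers» v4, stub `stub_diag`:
# **census R2 — a GLOBAL bound for the shell profile and the variation of `c_ab` on `[1, ∞)`**

The structure theorem `…DiagBoseMixedStructure.bose_coeff_structure` describes `c_ab` on `(0,1]`. On `[1,∞)` the Bose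
coefficient is exponentially small (`…DiagBoseDecay.abs_bose_coeff_le`); for the two-variable Abel step of the `stub_diag`
assembly one also needs its VARIATION there. Since `0 ≤ k_η ≤ k₀ = v/(1+v²)²` for EVERY `η > 0` (`…DiagBoseMixedProfile`):

* `abs_eta_mul_shell_profile_le` — **`|η·I_ab(η)| ≤ C(1+|log η|)^{a+b}` for all `η > 0`**;
* `abs_bose_coeff_sub_le_of_one_le` — **`|c_ab(y₁) − c_ab(y₂)| ≤ C(1+|log y₂|)^{a+b}(y₂−y₁)/y₁` for `1 ≤ y₁ ≤ y₂`**
  (shell identity `…DiagBoseMixedShell` + the profile bound): `c_ab` has polynomially controlled variation on `[1,∞)`.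

Def-free; theorems only. Helper `--supports stmt-Parity-20007`; closes nothing; K_A, K_B and the Parity summit are NOT
proved; nothing about Landau–Siegel zeros.

## References
* E. Kowalski, P. Michel, J. VanderKam, J. reine angew. Math. 526 (2000), (22)–(28) pp. 12–15.
  [cite: KowalskiMichelVanderKam2000, (22)–(28) — derivation (residues of the diagonal weight, real-variable form)]
-/

noncomputable section

open Real Set MeasureTheory Filter Function Finset

namespace Summit.Parity.GeneralizedHardyLittlewood.Theorems.MomentsBeyondDiagonal.DiagLines

/-- **Global bound for the shell profile.** For all `a, b` there is `C` with `|η·I_ab(η)| ≤ C(1+|log η|)^{a+b}` for every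
`η > 0`. [cite: KowalskiMichelVanderKam2000, (22)–(28) — derivation (one-variable profile of the diagonal weight)] -/
theorem abs_eta_mul_shell_profile_le (a b : ℕ) : ∃ C : ℝ, ∀ η : ℝ, 0 < η →
    |η * ∫ u in Ioi (0 : ℝ), Real.log u ^ a * Real.log (η / u) ^ b *
        (Real.exp (-(u + η / u)) / (1 - Real.exp (-(u + η / u))) ^ 2) / u| ≤ C * (1 + |Real.log η|) ^ (a + b) := by
  have hJ := integrableOn_one_add_abs_log_pow_div_sq (a + b)
  set J : ℝ := ∫ v in Ioi (0 : ℝ), (1 + |Real.log v|) ^ (a + b) / (1 + v) ^ 2 with hJdef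
  have hJ0 : 0 ≤ J := setIntegral_nonneg measurableSet_Ioi fun v (hv : 0 < v) ↦ by positivity
  refine ⟨4 * J, fun η hη ↦ ?_⟩
  rw [shell_profile_subst hη a b]
  set s : ℝ := Real.sqrt η with hs
  have hs0 : 0 < s := Real.sqrt_pos.2 hη
  have hlogs : |Real.log s| ≤ |Real.log η| := by
    rw [hs, Real.log_sqrt hη.le, abs_div, abs_two]
    linarith [abs_nonneg (Real.log η)]
  set X : ℝ := 1 + |Real.log η| with hX
  have hX0 : 0 ≤ X := by positivity
  -- majorant
  have hmaj : IntegrableOn (fun v : ℝ ↦ X ^ (a + b) * 4 * ((1 + |Real.log v|) ^ (a + b) / (1 + v) ^ 2)) (Ioi 0) :=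
    hJ.const_mul _
  have hptw : ∀ᵐ v ∂(volume.restrict (Ioi (0 : ℝ))),
      ‖(Real.log s + Real.log v) ^ a * (Real.log s - Real.log v) ^ b *
        (η * (Real.exp (-(s * (v + v⁻¹))) / (1 - Real.exp (-(s * (v + v⁻¹)))) ^ 2) / v)‖ ≤
      X ^ (a + b) * 4 * ((1 + |Real.log v|) ^ (a + b) / (1 + v) ^ 2) := by
    rw [ae_restrict_iff' measurableSet_Ioi]
    refine ae_of_all _ fun v (hv : 0 < v) ↦ ?_
    obtain ⟨hk0, hkle⟩ := shell_kernel_nonneg_le hη hv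
    rw [← hs] at hk0 hkle
    have hw := model_weight_le hv
    have h1 : |Real.log s + Real.log v| ≤ X * (1 + |Real.log v|) := by
      calc |Real.log s + Real.log v| ≤ |Real.log s| + |Real.log v| := abs_add_le _ _
        _ ≤ |Real.log η| + |Real.log v| := by linarith
        _ ≤ X * (1 + |Real.log v|) := by rw [hX]; nlinarith [abs_nonneg (Real.log η), abs_nonneg (Real.log v)]
    have h2 : |Real.log s - Real.log v| ≤ X * (1 + |Real.log v|) := by
      calc |Real.log s - Real.log v| ≤ |Real.log s| + |Real.log v| := abs_sub _ _
        _ ≤ |Real.log η| + |Real.log v| := by linarith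
        _ ≤ X * (1 + |Real.log v|) := by rw [hX]; nlinarith [abs_nonneg (Real.log η), abs_nonneg (Real.log v)]
    rw [Real.norm_eq_abs, abs_mul, abs_mul, abs_pow, abs_pow, abs_of_nonneg hk0]
    calc |Real.log s + Real.log v| ^ a * |Real.log s - Real.log v| ^ b *
          (η * (Real.exp (-(s * (v + v⁻¹))) / (1 - Real.exp (-(s * (v + v⁻¹)))) ^ 2) / v)
        ≤ (X * (1 + |Real.log v|)) ^ a * (X * (1 + |Real.log v|)) ^ b * (4 / (1 + v) ^ 2) :=
          mul_le_mul (mul_le_mul (pow_le_pow_left₀ (abs_nonneg _) h1 a) (pow_le_pow_left₀ (abs_nonneg _) h2 b)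
            (by positivity) (by positivity)) (hkle.trans hw) hk0 (by positivity)
      _ = X ^ (a + b) * 4 * ((1 + |Real.log v|) ^ (a + b) / (1 + v) ^ 2) := by
          rw [mul_pow, mul_pow, pow_add, pow_add]; ring
  have h := norm_integral_le_of_norm_le hmaj hptw
  rw [Real.norm_eq_abs, integral_const_mul] at h
  calc _ ≤ X ^ (a + b) * 4 * J := h
    _ = 4 * J * X ^ (a + b) := by ring

/-- **Variation of `c_ab` on `[1, ∞)`.** For all `a, b` there is `C` such that for `1 ≤ y₁ ≤ y₂`:
`|c_ab(y₁) − c_ab(y₂)| ≤ C(1+|log y₂|)^{a+b}(y₂−y₁)/y₁`.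
[cite: KowalskiMichelVanderKam2000, (22)–(28) — derivation (variation of the diagonal weight coefficients)] -/
theorem abs_bose_coeff_sub_le_of_one_le (a b : ℕ) : ∃ C : ℝ, ∀ y₁ y₂ : ℝ, 1 ≤ y₁ → y₁ ≤ y₂ →
    |(∫ u₁ in Ioi (0 : ℝ), Real.log u₁ ^ a *
        ∫ u₂ in Ioi (y₁ / u₁), Real.exp (-(u₁ + u₂)) / (1 - Real.exp (-(u₁ + u₂))) ^ 2 * Real.log u₂ ^ b) -
      (∫ u₁ in Ioi (0 : ℝ), Real.log u₁ ^ a *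
        ∫ u₂ in Ioi (y₂ / u₁), Real.exp (-(u₁ + u₂)) / (1 - Real.exp (-(u₁ + u₂))) ^ 2 * Real.log u₂ ^ b)| ≤
      C * (1 + |Real.log y₂|) ^ (a + b) * (y₂ - y₁) / y₁ := by
  obtain ⟨C, hC⟩ := abs_eta_mul_shell_profile_le a b
  have hC0 : 0 ≤ C := by
    have h := hC 1 one_pos
    have : (0 : ℝ) ≤ C * (1 + |Real.log 1|) ^ (a + b) := (abs_nonneg _).trans h
    simpa using this
  refine ⟨C, fun y₁ y₂ hy₁ h12 ↦ ?_⟩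
  have hy₁0 : 0 < y₁ := one_pos.trans_le hy₁
  rw [bose_coeff_sub_eq_integral_shell hy₁0 h12 a b]
  have hptw : ∀ η ∈ Ioc y₁ y₂, ‖∫ u in Ioi (0 : ℝ), Real.log u ^ a * Real.log (η / u) ^ b *
      (Real.exp (-(u + η / u)) / (1 - Real.exp (-(u + η / u))) ^ 2) / u‖ ≤ C * (1 + |Real.log y₂|) ^ (a + b) / y₁ := by
    intro η hη
    have hη0 : 0 < η := hy₁0.trans hη.1
    have hη1 : 1 ≤ η := hy₁.trans hη.1.le
    have h := hC η hη0
    have hlog : |Real.log η| ≤ |Real.log y₂| := by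
      rw [abs_of_nonneg (Real.log_nonneg hη1), abs_of_nonneg (Real.log_nonneg (hy₁.trans h12))]
      exact Real.log_le_log hη0 hη.2
    rw [abs_mul, abs_of_pos hη0] at h
    rw [Real.norm_eq_abs, le_div_iff₀ hy₁0]
    calc |∫ u in Ioi (0 : ℝ), Real.log u ^ a * Real.log (η / u) ^ b *
          (Real.exp (-(u + η / u)) / (1 - Real.exp (-(u + η / u))) ^ 2) / u| * y₁
        ≤ |∫ u in Ioi (0 : ℝ), Real.log u ^ a * Real.log (η / u) ^ b *
          (Real.exp (-(u + η / u)) / (1 - Real.exp (-(u + η / u))) ^ 2) / u| * η := by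
          gcongr; exact hη.1.le
      _ = η * |∫ u in Ioi (0 : ℝ), Real.log u ^ a * Real.log (η / u) ^ b *
          (Real.exp (-(u + η / u)) / (1 - Real.exp (-(u + η / u))) ^ 2) / u| := mul_comm _ _
      _ ≤ C * (1 + |Real.log η|) ^ (a + b) := h
      _ ≤ C * (1 + |Real.log y₂|) ^ (a + b) := by gcongr
  have h := norm_setIntegral_le_of_norm_le_const (μ := volume) (measure_Ioc_lt_top (a := y₁) (b := y₂)) hptw
  rw [Real.norm_eq_abs, Real.volume_real_Ioc_of_le h12] at h
  calc _ ≤ C * (1 + |Real.log y₂|) ^ (a + b) / y₁ * (y₂ - y₁) := h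
    _ = C * (1 + |Real.log y₂|) ^ (a + b) * (y₂ - y₁) / y₁ := by ring

end Summit.Parity.GeneralizedHardyLittlewood.Theorems.MomentsBeyondDiagonal.DiagLines

end
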